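import Summits.BirchSwinnertonDyer.BirchSwinnertonDyer.Theorems.ClassRecordThreeEulerHalvesAtThreeKolyvaginFamilyLineDefs
import Summits.BirchSwinnertonDyer.BirchSwinnertonDyer.Theorems.ClassRecordThreeEulerHalvesAtThreeSection6Joined
import HarnessLib

/-!
# (P2) WALK COMBINATOR for the GENERALISED Kolyvagin datum `JET.KolyvaginFamilyData W K ι n`: «(DIV) ⟸ {hswap, hlev}» —
# the end bridge `pDiv_of_perLevel`, Kolyvagin's redefinition of `m_∞` from the prime swap, and `pDiv_of_swap_of_perLevel`,
# twins (proofs VERBATIM, datum type replaced) of tam3-p1's `Koly.pDiv_of_perLevel` (`…Section6Bridge`) and corner-p1's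
# `Koly.kolyvaginRedefinition_of_swap` ∕ `Koly.pDiv_of_swap_of_perLevel` (`…KolyJRedefinition{,Sharp}`) (cell `bsd-stepL`,
# seat `bsd-stepL-tam3-p1` g12, owner of 19109's line; `--supports stmt-BirchSwinnertonDyer-19109 --as helper`)

WHY (PORT MAP (P2), RULING 46). On the `X₀(N)` datum, the registered Euler-system stub of 19109 reads
«`stub_jetchevMaxHLAtThree` ⟸ {hswap, hlev}» (`Koly.jetchevMaxHLAtThree_of_swap_of_perLevel'`), with hswap = bsd-jet's prime
swap (McCallum Prop. 5.2 in the kernel) and hlev = Jetchev's per-level inequality (the walk, Prop. 6.4 ∘ Thm. 6.3). This file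
states and proves the SAME combinator over `KolyvaginFamilyData` — datum-generic order theory over `PDiv` ∕ `divOrd` and
bsd-jet's abstract `JET.Section6.depth_le_mdiv_of_perLevel` — so that the Shimura walk's deliverables are now TYPED: the (DIV)
conjunct of `ShimuraKolyvaginOfImage.primitivesDivAtThreeInert` (in `PDiv` form, for every family datum over admissible
conductors of index `≥ s ≤ t`) follows from
* `hswap′` — the swap for family data (PORT MAP (P1); owner corner3-p2 per RULING 46 (4)), and
* `hlev′` — the per-level inequality for family data (PORT MAP (P2) proper; owner this seat),
both displayed below VERBATIM as the hypotheses of `pDiv_of_swap_of_perLevel`. Contents: `exists_finite_of_not_pDiv`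
(McCallum Lemma 5.1 at conductor 1), `pDiv_of_perLevel` (end bridge), `kolyvaginRedefinition_of_swap` (Lemma 5.1 + Prop. 5.2
from the swap), `pDiv_of_swap_of_perLevel` (the combinator, with the «no finite value» case split).

HONEST FRAMING: THEOREMS ONLY (no definition, no named fact, no `sorry`); hswap′ ∕ hlev′ are HYPOTHESES; nothing about any curve;
no item closes; BSD is not proved by any of this.
References: [cite: McCallumLMS1991, §5 Lemma 5.1, Prop. 5.2 (pp. 303–306)] [cite: Jetchev2008, Thm. 1.4 (p. 812), Proof of
Thm. 1.1 (p. 824), Proof of Thm. 1.4 (p. 825)] [cite: BurungaleEtAl2026, Prop. 2.2.1 (§2.2)] [cite: WZhang2014, Notations (xii)].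
presearch: not applicable (re-keying of tree theorems); `lean search 'KolyvaginFamilyData.pDiv_of_swap'` → none.
-/

set_option autoImplicit false

noncomputable section

open scoped Classical

universe u

namespace Summit.BirchSwinnertonDyer.Rank1Residual.JET.KolyvaginFamilyData

open WeierstrassCurve NumberField Literature.NumberTheory.EllipticCurves

variable {N : ℕ} {W : WeierstrassCurve ℚ} [W.IsGloballyMinimal] {K : Type u} [Field K] [NumberField K]
  {ι : K →+* ℂ}

/-! ### §1 McCallum Lemma 5.1 at conductor `1` -/

/-- If the conductor-`1` derived point is not `p^{M+1}`-divisible, some admissible `(n, d)` has `ord_p(P_n) < M(n)`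
(`M(1) = ∞`). [cite: McCallumLMS1991, §5 Lemma 5.1 (p. 303)] [cite: WZhang2014, Notations (xii)] -/
theorem exists_finite_of_not_pDiv {p M : ℕ} (d₁ : KolyvaginFamilyData W K ι 1) (h : ¬ d₁.PDiv p (M + 1)) :
    ∃ (n : ℕ) (d : KolyvaginFamilyData W K ι n), Squarefree n ∧
      (∀ ℓ ∈ n.primeFactors, Zhang2014.IsKolyvaginPrime N W K p ℓ) ∧
      d.divOrd p < Zhang2014.levelIndex W p n := by
  refine ⟨1, d₁, squarefree_one, by simp, ?_⟩
  rw [Zhang2014.levelIndex_one]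
  exact lt_of_le_of_lt (d₁.divOrd_le_of_not_pDiv p h) (ENat.coe_lt_top M)

/-! ### §2 The end bridge -/

/-- **`PDiv d p s` from the per-level inequality and Kolyvagin's redefinition, over family data** — twin of tam3-p1's
`Koly.pDiv_of_perLevel`: «admissible» conductors are the square-free `n` whose prime factors are Kolyvagin primes; `m n d` any
function with `m n d ≤ divOrd d p` whenever `divOrd d p < M(n)`; `hmInf : m_∞ ≤ m n d`; `hK` = admissible conductors of
arbitrarily large `M(n)` attain `m_∞`; `hlev` = «`m(n) < k`, `t ≤ k`, `k + m(n) ≤ M(n)` ⟹ `t ≤ m(n)`». CONCLUSION: for `s ≤ t`,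
every admissible `(n, d)` with all indices `≥ s` has `p^s | P_n`. [cite: Jetchev2008, Thm. 1.4 (p. 812) and its proof (p. 825)]
[cite: McCallumLMS1991, Prop. 5.2 (p. 304)] -/
theorem pDiv_of_perLevel (p t mInf : ℕ)
    (m : ∀ n : ℕ, KolyvaginFamilyData W K ι n → ℕ∞)
    (hm : ∀ (n : ℕ) (d : KolyvaginFamilyData W K ι n), Squarefree n →
      (∀ ℓ ∈ n.primeFactors, Zhang2014.IsKolyvaginPrime N W K p ℓ) →
      d.divOrd p < Zhang2014.levelIndex W p n → m n d ≤ d.divOrd p)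
    (hmInf : ∀ (n : ℕ) (d : KolyvaginFamilyData W K ι n), Squarefree n →
      (∀ ℓ ∈ n.primeFactors, Zhang2014.IsKolyvaginPrime N W K p ℓ) → (mInf : ℕ∞) ≤ m n d)
    (hK : ∀ m' : ℕ, ∃ (n : ℕ) (d : KolyvaginFamilyData W K ι n), Squarefree n ∧
      (∀ ℓ ∈ n.primeFactors, Zhang2014.IsKolyvaginPrime N W K p ℓ) ∧
      (m' : ℕ∞) ≤ Zhang2014.levelIndex W p n ∧ m n d = mInf)
    (hlev : ∀ (k : ℕ) (n : ℕ) (d : KolyvaginFamilyData W K ι n), Squarefree n →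
      (∀ ℓ ∈ n.primeFactors, Zhang2014.IsKolyvaginPrime N W K p ℓ) →
      m n d < (k : ℕ∞) → t ≤ k → (k : ℕ∞) + m n d ≤ Zhang2014.levelIndex W p n →
      (t : ℕ∞) ≤ m n d)
    (s : ℕ) (hs : s ≤ t) (n : ℕ) (d : KolyvaginFamilyData W K ι n) (hn : Squarefree n)
    (hℓ : ∀ ℓ ∈ n.primeFactors,
      Zhang2014.IsKolyvaginPrime N W K p ℓ ∧ s ≤ Zhang2014.kolyvaginIndex W p ℓ) :
    d.PDiv p s := by
  -- the admissible conductors with their data, as one index type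
  let Λ : Type u := {c : Σ n : ℕ, KolyvaginFamilyData W K ι n //
    Squarefree c.1 ∧ ∀ ℓ ∈ c.1.primeFactors, Zhang2014.IsKolyvaginPrime N W K p ℓ}
  have hkol : ∀ ℓ ∈ n.primeFactors, Zhang2014.IsKolyvaginPrime N W K p ℓ := fun ℓ h => (hℓ ℓ h).1
  let c₀ : Λ := ⟨⟨n, d⟩, hn, hkol⟩
  have key := JET.Section6.depth_le_mdiv_of_perLevel (Λ := Λ)
    (fun c => Zhang2014.levelIndex W p c.1.1) (fun c => c.1.2.divOrd p) (fun c => m c.1.1 c.1.2)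
    (fun c h => hm c.1.1 c.1.2 c.2.1 c.2.2 h) t mInf (fun c => hmInf c.1.1 c.1.2 c.2.1 c.2.2)
    (fun m' => by
      obtain ⟨n', d', hn', hℓ', hM', hm'⟩ := hK m'
      exact ⟨⟨⟨n', d'⟩, hn', hℓ'⟩, hM', hm'⟩)
    (fun k c h1 h2 h3 => hlev k c.1.1 c.1.2 c.2.1 c.2.2 h1 h2 h3)
    s hs c₀ (Zhang2014.natCast_le_levelIndex_iff.mpr fun ℓ h => (hℓ ℓ h).2)
  exact d.pDiv_of_le_divOrd p s key

/-! ### §3 Kolyvagin's redefinition of `m_∞` from the swap -/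

/-- **Kolyvagin's redefinition of `m_∞` (McCallum Lemma 5.1 + Prop. 5.2, `C = {0}`) from the PRIME SWAP, over family data**
— twin of corner-p1's `Koly.kolyvaginRedefinition_of_swap` (proof verbatim). `hfin`: some admissible `(n, d)` has
`ord_p(P_n) < M(n)`; `hswap`: the instantiated conclusion of the swap. CONCLUSION: `∃ m_∞ : ℕ` bounding `m(n, d)` below on
admissible data and attained at admissible conductors of arbitrarily large `M(n)`.
[cite: McCallumLMS1991, §5 Lemma 5.1, Prop. 5.2 (pp. 303–306)] [cite: BurungaleEtAl2026, Prop. 2.2.1 (§2.2)]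
[cite: Jetchev2008, Proof of Thm. 1.1 (p. 824)] -/
theorem kolyvaginRedefinition_of_swap (p : ℕ)
    (hfin : ∃ (n : ℕ) (d : KolyvaginFamilyData W K ι n), Squarefree n ∧
      (∀ ℓ ∈ n.primeFactors, Zhang2014.IsKolyvaginPrime N W K p ℓ) ∧
      d.divOrd p < Zhang2014.levelIndex W p n)
    (hswap : ∀ (M e : ℕ) (n : ℕ) (d : KolyvaginFamilyData W K ι n), Squarefree n →
      (∀ ℓ ∈ n.primeFactors, Zhang2014.IsKolyvaginPrime N W K p ℓ ∧ M + 1 ≤ Zhang2014.kolyvaginIndex W p ℓ) →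
      (∀ (n' : ℕ) (d' : KolyvaginFamilyData W K ι n'), Squarefree n' →
        (∀ ℓ ∈ n'.primeFactors, Zhang2014.IsKolyvaginPrime N W K p ℓ ∧ M + 1 ≤ Zhang2014.kolyvaginIndex W p ℓ) →
        d'.PDiv p M) →
      ¬ d.PDiv p (M + 1) →
      ∃ (n' : ℕ) (d' : KolyvaginFamilyData W K ι n'), Squarefree n' ∧
        (∀ ℓ ∈ n'.primeFactors, Zhang2014.IsKolyvaginPrime N W K p ℓ ∧ e ≤ Zhang2014.kolyvaginIndex W p ℓ) ∧
        ¬ d'.PDiv p (M + 1)) :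
    ∃ mInf : ℕ,
      (∀ (n : ℕ) (d : KolyvaginFamilyData W K ι n), Squarefree n →
        (∀ ℓ ∈ n.primeFactors, Zhang2014.IsKolyvaginPrime N W K p ℓ) →
        (mInf : ℕ∞) ≤ (if d.divOrd p < Zhang2014.levelIndex W p n then d.divOrd p else ⊤)) ∧
      (∀ m' : ℕ, ∃ (n : ℕ) (d : KolyvaginFamilyData W K ι n), Squarefree n ∧
        (∀ ℓ ∈ n.primeFactors, Zhang2014.IsKolyvaginPrime N W K p ℓ) ∧
        (m' : ℕ∞) ≤ Zhang2014.levelIndex W p n ∧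
        (if d.divOrd p < Zhang2014.levelIndex W p n then d.divOrd p else (⊤ : ℕ∞)) = mInf) := by
  -- the set of FINITE values `ord_p(P_n) < M(n)` over admissible `(n, d)`
  let S : Set ℕ := {u | ∃ (n : ℕ) (d : KolyvaginFamilyData W K ι n), Squarefree n ∧
    (∀ ℓ ∈ n.primeFactors, Zhang2014.IsKolyvaginPrime N W K p ℓ) ∧
    d.divOrd p = (u : ℕ∞) ∧ (u : ℕ∞) < Zhang2014.levelIndex W p n}
  have hmemS : ∀ (n : ℕ) (d : KolyvaginFamilyData W K ι n), Squarefree n →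
      (∀ ℓ ∈ n.primeFactors, Zhang2014.IsKolyvaginPrime N W K p ℓ) →
      d.divOrd p < Zhang2014.levelIndex W p n → (d.divOrd p).toNat ∈ S ∧ d.divOrd p = ((d.divOrd p).toNat : ℕ∞) := by
    intro n d hn hadm hlt
    have hne : d.divOrd p ≠ ⊤ := ne_top_of_lt hlt
    have heq : d.divOrd p = ((d.divOrd p).toNat : ℕ∞) := (ENat.coe_toNat hne).symm
    exact ⟨⟨n, d, hn, hadm, heq, heq ▸ hlt⟩, heq⟩
  obtain ⟨n₀, d₀, hn₀, hadm₀, hlt₀⟩ := hfin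
  have hS : S.Nonempty := ⟨_, (hmemS n₀ d₀ hn₀ hadm₀ hlt₀).1⟩
  set mInf : ℕ := sInf S with hmInf_def
  have hmem : mInf ∈ S := Nat.sInf_mem hS
  have hle : ∀ u ∈ S, mInf ≤ u := fun u hu => Nat.sInf_le hu
  have hclause1 : ∀ (n : ℕ) (d : KolyvaginFamilyData W K ι n), Squarefree n →
      (∀ ℓ ∈ n.primeFactors, Zhang2014.IsKolyvaginPrime N W K p ℓ) →
      (mInf : ℕ∞) ≤ (if d.divOrd p < Zhang2014.levelIndex W p n then d.divOrd p else ⊤) := by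
    intro n d hn hadm
    by_cases h : d.divOrd p < Zhang2014.levelIndex W p n
    · rw [if_pos h]
      obtain ⟨hu, heq⟩ := hmemS n d hn hadm h
      rw [heq]
      exact_mod_cast hle _ hu
    · rw [if_neg h]; exact le_top
  have hall : ∀ (n' : ℕ) (d' : KolyvaginFamilyData W K ι n'), Squarefree n' →
      (∀ ℓ ∈ n'.primeFactors, Zhang2014.IsKolyvaginPrime N W K p ℓ ∧ mInf + 1 ≤ Zhang2014.kolyvaginIndex W p ℓ) →
      d'.PDiv p mInf := by
    intro n' d' hn' hadm'
    apply d'.pDiv_of_le_divOrd p mInf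
    by_cases h : d'.divOrd p < Zhang2014.levelIndex W p n'
    · obtain ⟨hu, heq⟩ := hmemS n' d' hn' (fun ℓ hℓ => (hadm' ℓ hℓ).1) h
      rw [heq]
      exact_mod_cast hle _ hu
    · have hidx : ((mInf + 1 : ℕ) : ℕ∞) ≤ Zhang2014.levelIndex W p n' :=
        Zhang2014.natCast_le_levelIndex_iff.mpr fun ℓ hℓ => (hadm' ℓ hℓ).2
      calc (mInf : ℕ∞) ≤ ((mInf + 1 : ℕ) : ℕ∞) := by exact_mod_cast Nat.le_succ mInf
        _ ≤ Zhang2014.levelIndex W p n' := hidx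
        _ ≤ d'.divOrd p := not_lt.mp h
  refine ⟨mInf, hclause1, fun m' => ?_⟩
  obtain ⟨n₁, d₁, hn₁, hadm₁, hdiv₁, hlt₁⟩ := hmem
  have hidx₁ : ∀ ℓ ∈ n₁.primeFactors,
      Zhang2014.IsKolyvaginPrime N W K p ℓ ∧ mInf + 1 ≤ Zhang2014.kolyvaginIndex W p ℓ := by
    have h1 : ((mInf + 1 : ℕ) : ℕ∞) ≤ Zhang2014.levelIndex W p n₁ := by
      have := Order.add_one_le_of_lt hlt₁
      exact_mod_cast this
    exact fun ℓ hℓ => ⟨hadm₁ ℓ hℓ, Zhang2014.natCast_le_levelIndex_iff.mp h1 ℓ hℓ⟩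
  have hnot₁ : ¬ d₁.PDiv p (mInf + 1) := by
    intro h
    have h1 : ((mInf + 1 : ℕ) : ℕ∞) ≤ d₁.divOrd p := d₁.natCast_le_divOrd_of_pDiv p h
    rw [hdiv₁] at h1
    have : mInf + 1 ≤ mInf := by exact_mod_cast h1
    omega
  obtain ⟨n', d', hn', hidx', hnot'⟩ := hswap mInf (max m' (mInf + 2)) n₁ d₁ hn₁ hidx₁ hall hnot₁
  have hadm' : ∀ ℓ ∈ n'.primeFactors, Zhang2014.IsKolyvaginPrime N W K p ℓ := fun ℓ hℓ => (hidx' ℓ hℓ).1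
  have hM' : ((max m' (mInf + 2) : ℕ) : ℕ∞) ≤ Zhang2014.levelIndex W p n' :=
    Zhang2014.natCast_le_levelIndex_iff.mpr fun ℓ hℓ => (hidx' ℓ hℓ).2
  have hdiv' : d'.divOrd p = (mInf : ℕ∞) := by
    apply le_antisymm (d'.divOrd_le_of_not_pDiv p hnot')
    exact d'.natCast_le_divOrd_of_pDiv p
      (hall n' d' hn' fun ℓ hℓ => ⟨(hidx' ℓ hℓ).1, le_trans (by omega) (le_trans (le_max_right _ _) (hidx' ℓ hℓ).2)⟩)
  have hlt' : d'.divOrd p < Zhang2014.levelIndex W p n' := by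
    rw [hdiv']
    calc (mInf : ℕ∞) < ((max m' (mInf + 2) : ℕ) : ℕ∞) := by exact_mod_cast (by omega : mInf < max m' (mInf + 2))
      _ ≤ Zhang2014.levelIndex W p n' := hM'
  refine ⟨n', d', hn', hadm', le_trans (by exact_mod_cast le_max_left m' (mInf + 2)) hM', ?_⟩
  rw [if_pos hlt', hdiv']

/-! ### §4 The combinator «(DIV) ⟸ {hswap′, hlev′}» -/

/-- **`p^s | P_n` for every admissible family datum of index `≥ s ≤ t`, from {hswap′, hlev′} ALONE** — twin of corner-p1's
`Koly.pDiv_of_swap_of_perLevel`: if some admissible `(n, d)` has `ord_p(P_n) < M(n)`, this is `kolyvaginRedefinition_of_swap`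
+ `pDiv_of_perLevel`; otherwise every admissible derived point is `p^{M(n)}`-divisible and the conclusion is immediate. THE
TYPED DELIVERABLES OF THE SHIMURA WALK: `hswap` (PORT MAP (P1)) and `hlev` (PORT MAP (P2)) below, VERBATIM.
CONDITIONAL on both; nothing booked. [cite: McCallumLMS1991, §5 Prop. 5.2 (p. 304)] [cite: Jetchev2008, Thm. 1.4 (p. 812)] -/
theorem pDiv_of_swap_of_perLevel (p t : ℕ)
    (hswap : ∀ (M e : ℕ) (n : ℕ) (d : KolyvaginFamilyData W K ι n), Squarefree n →
      (∀ ℓ ∈ n.primeFactors, Zhang2014.IsKolyvaginPrime N W K p ℓ ∧ M + 1 ≤ Zhang2014.kolyvaginIndex W p ℓ) →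
      (∀ (n' : ℕ) (d' : KolyvaginFamilyData W K ι n'), Squarefree n' →
        (∀ ℓ ∈ n'.primeFactors, Zhang2014.IsKolyvaginPrime N W K p ℓ ∧ M + 1 ≤ Zhang2014.kolyvaginIndex W p ℓ) →
        d'.PDiv p M) →
      ¬ d.PDiv p (M + 1) →
      ∃ (n' : ℕ) (d' : KolyvaginFamilyData W K ι n'), Squarefree n' ∧
        (∀ ℓ ∈ n'.primeFactors, Zhang2014.IsKolyvaginPrime N W K p ℓ ∧ e ≤ Zhang2014.kolyvaginIndex W p ℓ) ∧
        ¬ d'.PDiv p (M + 1))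
    (hlev : ∀ (k n : ℕ) (d : KolyvaginFamilyData W K ι n), Squarefree n →
      (∀ ℓ ∈ n.primeFactors, Zhang2014.IsKolyvaginPrime N W K p ℓ) →
      (if d.divOrd p < Zhang2014.levelIndex W p n then d.divOrd p else (⊤ : ℕ∞)) < (k : ℕ∞) → t ≤ k →
      (k : ℕ∞) + (if d.divOrd p < Zhang2014.levelIndex W p n then d.divOrd p else ⊤) ≤ Zhang2014.levelIndex W p n →
      (t : ℕ∞) ≤ (if d.divOrd p < Zhang2014.levelIndex W p n then d.divOrd p else ⊤))
    (s : ℕ) (hs : s ≤ t) (n : ℕ) (d : KolyvaginFamilyData W K ι n) (hn : Squarefree n)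
    (hℓ : ∀ ℓ ∈ n.primeFactors, Zhang2014.IsKolyvaginPrime N W K p ℓ ∧ s ≤ Zhang2014.kolyvaginIndex W p ℓ) :
    d.PDiv p s := by
  by_cases hfin : ∃ (n' : ℕ) (d' : KolyvaginFamilyData W K ι n'), Squarefree n' ∧
      (∀ ℓ ∈ n'.primeFactors, Zhang2014.IsKolyvaginPrime N W K p ℓ) ∧ d'.divOrd p < Zhang2014.levelIndex W p n'
  · obtain ⟨mInf, hmInf, hK⟩ := kolyvaginRedefinition_of_swap p hfin hswap
    exact pDiv_of_perLevel p t mInf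
      (fun n d => if d.divOrd p < Zhang2014.levelIndex W p n then d.divOrd p else ⊤)
      (fun n d _ _ h => by simp [h]) hmInf hK hlev s hs n d hn hℓ
  · push Not at hfin
    apply d.pDiv_of_le_divOrd p s
    calc (s : ℕ∞) ≤ Zhang2014.levelIndex W p n := Zhang2014.natCast_le_levelIndex_iff.mpr fun ℓ h => (hℓ ℓ h).2
      _ ≤ d.divOrd p := hfin n d hn fun ℓ h => (hℓ ℓ h).1

end Summit.BirchSwinnertonDyer.Rank1Residual.JET.KolyvaginFamilyData

end
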